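import Mathlib
import Summits.KontsevichZagierPeriods.Zeta5Search.BrickWeightDescentTwo
import Summits.KontsevichZagierPeriods.Zeta5Search.BrickDigitSideZero
import Summits.KontsevichZagierPeriods.Zeta5Search.Zudilin2002IntegralityCentreFree

/-!
# BrickPropositionHTwo — PROPOSITION H at the prime `2` for the centre-free brick kernels: for `A` even, `1 ≤ B`,
`2B ≤ A`, EVERY level `ℓ`, every row `M < 2^{ℓ+1}` and every 2-ADMISSIBLE weight `g`,
`v₂(Σ_{k≤M} g(k)·2^{ℓ(A−s)}c̃_{k,s}(M)) ≤ exp(−ℓ)` (all `s`) and the harmonic cell — and, through ct-1 g41's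
`integrality_of_propositionH_two`, **Zudilin's 2002 integrality `4D_n²qₙ, 4D_n⁷pₙ, 4D_n⁵p̃ₙ ∈ ℤ` as a theorem of the tree**
(cell `pub-zeta5`, seat ct-1 g43)

HONEST FRAMING: systematic search; no irrationality claim unless certified.  `2`-adic bookkeeping of the partial-fraction
cells of the brick kernels `R_n(t) = n!^{A−2B}(t−n)_n^B(t+n+1)_n^B/(t)_{n+1}^A` and, at `(A,B) = (6,1)`, the printed
denominator statement of Zudilin (Mat. Zametki **72** (2002), Sect. 1 display before (6), Sect. 2 (14)–(15)) for the
coefficients of his `ζ(5)`/`ζ(3)` linear forms.  Nothing here concerns the arithmetic nature of `ζ(5)`/`ζ(3)`: no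
irrationality or measure statement, no `γ`, no record statement; records in print UNMOVED.  ONE named fact is
DISCHARGED: `Literature.NumberTheory.Irrationality.Zudilin2002.integrality` (`integrality_holds`).

THE ARCHITECTURE is zi-eng's `BrickPropositionHInf` (odd primes) with the three `p = 2` replacements found by ct-1 g41–g43:
(1) the KERNEL side — ct-1 g42's one-level reduction at `2` for both row parities (`BrickLevelReductionTwo`: Φ on even
poles of even rows, the hat on their holes, `Ψ, Ψ′` on odd rows); (2) the WEIGHT side — the 2-admissible class
((I) `g ∈ ℤ_(2)`, (S) `g(M−k) + g(k) = 0` EXACTLY, (D⁺) `2^e ∣ k − k′ ⇒ 2^{e+1} ∣ g(k′) − g(k)` for `0 ≤ e ≤ ℓ`), closed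
under `ω = W/2`, `γ = G/2^A` (`BrickWeightDescentTwo`); (3) «`W ≡ 0 (mod 2)`» from `B ≥ 1` on odd rows
(`BrickBlockWeightTwo.blockWeight_two_odd_le`) and from the evenness of `g` on even rows (`BrickWeightDescentTwo.even_row_le`)
— the odd-prime argument `2S₀ ≡ 0 ⇒ S₀ ≡ 0` being void at `2`.

* `level_step_two_odd`, `level_step_two_even` — the induction step on the rows `2N+1` (cells to the row `N`) and `2N+2`
  (cells to the row `N+1`, holes to the row `N`);
* **`propositionH_two`** — PROPOSITION H at `2`, every level (base `M ≤ 1`: `BrickCellsAllPrimes.cell_zero_integral_of_lt`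
  and the one-digit harmonic cell);
* `propositionH_two_linear` — the instance `g(k) = n − 2k` (2-admissible at every level: `g(k′) − g(k) = 2(k − k′)`);
* **`integrality_holds : Zudilin2002.integrality`** — by `Zudilin2002IntegralityCentreFree.integrality_of_propositionH_two`.

DATA (seat desk, exact, not used by the kernel): the conclusion holds with margin exactly `1` along the whole descent tree of
`n − 2k` for `(6,1,0)`, `n ≤ 100`; ct-1 g41: `ord₂(W_5) = ord₂(D_n²W_3) = ord₂(D_n⁵W_0) = 1` for `n ≤ 170`.  Theorems only
(0 `def`); tree vocabulary; nothing restated.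
-/

namespace Summit.KontsevichZagierPeriods.Zeta5Search.BrickPropositionHTwo

open Finset Nat WithZero
open Summit.KontsevichZagierPeriods.Zeta5Search.BrickLaurent (cell)
open Summit.KontsevichZagierPeriods.Zeta5Search.BrickPartialFractions (cellZero)
open Summit.KontsevichZagierPeriods.Zeta5Search.BrickLevelReduction (blockWeight)
open Summit.KontsevichZagierPeriods.Zeta5Search.BrickHoleWeight (holeWeight)
open Summit.KontsevichZagierPeriods.Zeta5Search.BrickDigitStepDZero (cellZero_eq)
open Summit.KontsevichZagierPeriods.Zeta5Search.BrickDigitSideZero (hsum_integral_of_lt)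
open Summit.KontsevichZagierPeriods.Zeta5Search.BrickCellsAllPrimes (cell_zero_integral_of_lt)
open Summit.KontsevichZagierPeriods.Zeta5Search.BrickResidueLawTwo (padicValuation_two padicValuation_two_pow)
open Summit.KontsevichZagierPeriods.Zeta5Search.BrickLevelReductionTwo (level_reduction_two_odd level_reduction_two_odd_zero
  level_reduction_two_even level_reduction_two_even_zero)
open Summit.KontsevichZagierPeriods.Zeta5Search.BrickBlockWeightTwo (blockWeight_two_odd_le padicValuation_blockWeight_two_even
  holeWeight_two_le)
open Summit.KontsevichZagierPeriods.Zeta5Search.BrickWeightDescentTwo (padicValuation_natCast_sub_le blockWeight_two_odd_reflect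
  blockWeight_two_odd_local even_row_le blockWeight_two_even_reflect blockWeight_two_even_local holeWeight_two_reflect
  holeWeight_two_local)
open Summit.KontsevichZagierPeriods.Zeta5Search.Zudilin2002IntegralityCentreFree (integrality_of_propositionH_two)
open Literature.NumberTheory.Irrationality.Zudilin2002 (integrality)

noncomputable section

/-- Division by `2^c` raises a valuation bound by `c`: `v₂(x) ≤ exp(m) ⇒ v₂(x/2^c) ≤ exp(m + c)`. -/
theorem padicValuation_div_two_pow_le {x : ℚ} {m : ℤ} (c : ℕ) (h : Rat.padicValuation 2 x ≤ exp m) :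
    Rat.padicValuation 2 (x / (2 : ℚ) ^ c) ≤ exp (m + c) := by
  rw [map_div₀, padicValuation_two_pow, div_le_iff₀ (zero_lt_iff.2 exp_ne_zero), ← exp_add]
  simpa using h

/-- A weighted sum with weights `2^c·u` is `2^c` times the sum with weights `u`. -/
theorem sum_pow_mul (c M : ℕ) (u f : ℕ → ℚ) :
    ∑ K ∈ range (M + 1), ((2 : ℚ) ^ c * u K) * f K = (2 : ℚ) ^ c * ∑ K ∈ range (M + 1), u K * f K := by
  rw [Finset.mul_sum]; exact Finset.sum_congr rfl fun K _ => by ring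

/-! ## The induction step -/

section step

variable {A B L : ℕ} (hA : Even A) (hB : 1 ≤ B) (hAB : 2 * B ≤ A)
  (IH : ∀ M, M < 2 ^ (L + 1) → ∀ g' : ℕ → ℚ, (∀ K, K ≤ M → Rat.padicValuation 2 (g' K) ≤ 1) →
    (∀ K, K ≤ M → g' (M - K) + g' K = 0) →
    (∀ e K K', e ≤ L → K ≤ M → K' ≤ M → (2 : ℤ) ^ e ∣ (K : ℤ) - K' →
      Rat.padicValuation 2 (g' K' - g' K) ≤ exp (-((e : ℤ) + 1))) →
    (∀ s, Rat.padicValuation 2 (∑ K ∈ range (M + 1), g' K * ((2 : ℚ) ^ (L * (A - s)) * cell A B 0 M K s)) ≤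
      exp (-(L : ℤ))) ∧
    Rat.padicValuation 2 (∑ K ∈ range (M + 1), g' K * ((2 : ℚ) ^ (L * A) * cellZero A B 0 M K)) ≤ exp (-(L : ℤ)))
include hA hB hAB IH

/-- **The induction step on an ODD row `2N+1`** (`N < 2^{L+1}`, `g` 2-admissible at level `L+1` on `[0, 2N+1]`): the cells
descend to the row `N` with the weight `W = 2ω`, `ω` 2-admissible at level `L` (`BrickWeightDescentTwo`), and
`BrickLevelReductionTwo.level_reduction_two_odd{,_zero}` + the hypothesis at level `L` give level `L+1`. -/
theorem level_step_two_odd {N : ℕ} (hN : N < 2 ^ (L + 1)) {g : ℕ → ℚ}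
    (hgI : ∀ k, k ≤ 2 * N + 1 → Rat.padicValuation 2 (g k) ≤ 1)
    (hgS : ∀ k, k ≤ 2 * N + 1 → g (2 * N + 1 - k) + g k = 0)
    (hgD : ∀ e k k', e ≤ L + 1 → k ≤ 2 * N + 1 → k' ≤ 2 * N + 1 → (2 : ℤ) ^ e ∣ (k : ℤ) - k' →
      Rat.padicValuation 2 (g k' - g k) ≤ exp (-((e : ℤ) + 1))) :
    (∀ s, Rat.padicValuation 2 (∑ k ∈ range (2 * N + 1 + 1),
      g k * ((2 : ℚ) ^ ((L + 1) * (A - s)) * cell A B 0 (2 * N + 1) k s)) ≤ exp (-((L : ℤ) + 1))) ∧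
    Rat.padicValuation 2 (∑ k ∈ range (2 * N + 1 + 1),
      g k * ((2 : ℚ) ^ ((L + 1) * A) * cellZero A B 0 (2 * N + 1) k)) ≤ exp (-((L : ℤ) + 1)) := by
  set W : ℕ → ℚ := blockWeight A B 0 2 1 N g with hW
  set ω : ℕ → ℚ := fun K => W K / 2 with hω
  have hWω : ∀ K, W K = (2 : ℚ) ^ 1 * ω K := fun K => by rw [hω]; simp only; rw [pow_one, mul_div_cancel₀ _ two_ne_zero]
  -- `ω` is 2-admissible for `N` at level `L`
  have hωI : ∀ K, K ≤ N → Rat.padicValuation 2 (ω K) ≤ 1 := fun K hK => by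
    have h := padicValuation_div_two_pow_le 1
      (blockWeight_two_odd_le hAB hK (hgI (2 * K) (by omega)) (hgI (2 * K + 1) (by omega)))
    rw [pow_one] at h
    exact h.trans (by rw [← exp_zero, exp_le_exp]; push_cast; omega)
  have hωS : ∀ K, K ≤ N → ω (N - K) + ω K = 0 := fun K hK => by
    rw [hω]; simp only; rw [← add_div, hW, blockWeight_two_odd_reflect hA hgS hK, zero_div]
  have hωD : ∀ e K K', e ≤ L → K ≤ N → K' ≤ N → (2 : ℤ) ^ e ∣ (K : ℤ) - K' →
      Rat.padicValuation 2 (ω K' - ω K) ≤ exp (-((e : ℤ) + 1)) := fun e K K' he hK hK' hdvd => by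
    rw [hω]; simp only; rw [← sub_div]
    have h := padicValuation_div_two_pow_le 1 (blockWeight_two_odd_local hA hB hAB hgI hgS hgD he hK hK' hdvd)
    rw [pow_one] at h
    exact h.trans (by rw [exp_le_exp]; push_cast; omega)
  obtain ⟨IHs, IH0⟩ := IH N hN ω hωI hωS hωD
  refine ⟨fun s => ?_, ?_⟩
  · have hred := level_reduction_two_odd hAB hB hN hgI s
    have hmain : Rat.padicValuation 2 (∑ K ∈ range (N + 1),
        blockWeight A B 0 2 1 N g K * ((2 : ℚ) ^ (L * (A - s)) * cell A B 0 N K s)) ≤ exp (-((L : ℤ) + 1)) := by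
      rw [← hW, show ∑ K ∈ range (N + 1), W K * ((2 : ℚ) ^ (L * (A - s)) * cell A B 0 N K s) =
        ∑ K ∈ range (N + 1), ((2 : ℚ) ^ 1 * ω K) * ((2 : ℚ) ^ (L * (A - s)) * cell A B 0 N K s) from
          Finset.sum_congr rfl fun K _ => by rw [hWω K], sum_pow_mul, map_mul, padicValuation_two_pow]
      calc _ ≤ exp (-((1 : ℕ) : ℤ)) * exp (-(L : ℤ)) := mul_le_mul' le_rfl (IHs s)
        _ = _ := by rw [← exp_add]; congr 1; push_cast; ring
    have h := Valuation.map_add_le _ hred hmain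
    rwa [sub_add_cancel] at h
  · have hred := level_reduction_two_odd_zero hAB hB hN hgI
    have hmain : Rat.padicValuation 2 (∑ K ∈ range (N + 1),
        blockWeight A B 0 2 1 N g K * ((2 : ℚ) ^ (L * A) * cellZero A B 0 N K)) ≤ exp (-((L : ℤ) + 1)) := by
      rw [← hW, show ∑ K ∈ range (N + 1), W K * ((2 : ℚ) ^ (L * A) * cellZero A B 0 N K) =
        ∑ K ∈ range (N + 1), ((2 : ℚ) ^ 1 * ω K) * ((2 : ℚ) ^ (L * A) * cellZero A B 0 N K) from
          Finset.sum_congr rfl fun K _ => by rw [hWω K], sum_pow_mul, map_mul, padicValuation_two_pow]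
      calc _ ≤ exp (-((1 : ℕ) : ℤ)) * exp (-(L : ℤ)) := mul_le_mul' le_rfl IH0
        _ = _ := by rw [← exp_add]; congr 1; push_cast; ring
    have h := Valuation.map_add_le _ hred hmain
    rwa [sub_add_cancel] at h

/-- **The induction step on an EVEN row `2N+2`** (`N + 1 < 2^{L+1}`, `g` 2-admissible at level `L+1` on `[0, 2N+2]`):
the ° cells descend to the row `N+1` with `W = 2ω` and the holes to the row `N` with `G = 2^A γ`, `ω`, `γ` 2-admissible at
level `L` (`BrickWeightDescentTwo`); `BrickLevelReductionTwo.level_reduction_two_even{,_zero}` + the hypothesis at level `L`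
on both rows give level `L+1` (`A ≥ 2` absorbs the holes). -/
theorem level_step_two_even {N : ℕ} (hN : N + 1 < 2 ^ (L + 1)) {g : ℕ → ℚ}
    (hgI : ∀ k, k ≤ 2 * N + 2 → Rat.padicValuation 2 (g k) ≤ 1)
    (hgS : ∀ k, k ≤ 2 * N + 2 → g (2 * N + 2 - k) + g k = 0)
    (hgD : ∀ e k k', e ≤ L + 1 → k ≤ 2 * N + 2 → k' ≤ 2 * N + 2 → (2 : ℤ) ^ e ∣ (k : ℤ) - k' →
      Rat.padicValuation 2 (g k' - g k) ≤ exp (-((e : ℤ) + 1))) :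
    (∀ s, Rat.padicValuation 2 (∑ k ∈ range (2 * N + 2 + 1),
      g k * ((2 : ℚ) ^ ((L + 1) * (A - s)) * cell A B 0 (2 * N + 2) k s)) ≤ exp (-((L : ℤ) + 1))) ∧
    Rat.padicValuation 2 (∑ k ∈ range (2 * N + 2 + 1),
      g k * ((2 : ℚ) ^ ((L + 1) * A) * cellZero A B 0 (2 * N + 2) k)) ≤ exp (-((L : ℤ) + 1)) := by
  have hA1 : 1 ≤ A := by omega
  have hN' : N < 2 ^ (L + 1) := by omega
  -- the block weight `W = 2ω` on the row `N+1`
  set W : ℕ → ℚ := blockWeight A B 0 2 0 (N + 1) g with hW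
  set ω : ℕ → ℚ := fun K => W K / 2 with hω
  have hWω : ∀ K, W K = (2 : ℚ) ^ 1 * ω K := fun K => by rw [hω]; simp only; rw [pow_one, mul_div_cancel₀ _ two_ne_zero]
  have hωI : ∀ K, K ≤ N + 1 → Rat.padicValuation 2 (ω K) ≤ 1 := fun K hK => by
    have hWK : Rat.padicValuation 2 (W K) ≤ exp (-1 : ℤ) := by
      rw [hW, padicValuation_blockWeight_two_even hAB hK]; exact even_row_le hgS hgD (by omega)
    have h := padicValuation_div_two_pow_le 1 hWK
    rw [pow_one] at h
    exact h.trans (by rw [← exp_zero, exp_le_exp]; norm_num)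
  have hωS : ∀ K, K ≤ N + 1 → ω (N + 1 - K) + ω K = 0 := fun K hK => by
    rw [hω]; simp only; rw [← add_div, hW, blockWeight_two_even_reflect hA hAB hgS hK, zero_div]
  have hωD : ∀ e K K', e ≤ L → K ≤ N + 1 → K' ≤ N + 1 → (2 : ℤ) ^ e ∣ (K : ℤ) - K' →
      Rat.padicValuation 2 (ω K' - ω K) ≤ exp (-((e : ℤ) + 1)) := fun e K K' he hK hK' hdvd => by
    rw [hω]; simp only; rw [← sub_div]
    have h := padicValuation_div_two_pow_le 1 (blockWeight_two_even_local hAB hgS hgD he hK hK' hdvd)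
    rw [pow_one] at h
    exact h.trans (by rw [exp_le_exp]; push_cast; omega)
  obtain ⟨IHs, IH0⟩ := IH (N + 1) hN ω hωI hωS hωD
  -- the hole weight `G = 2^A γ` on the row `N`
  set G : ℕ → ℚ := holeWeight A B 0 2 0 N g with hG
  set γ : ℕ → ℚ := fun K => G K / (2 : ℚ) ^ A with hγ
  have hGγ : ∀ K, G K = (2 : ℚ) ^ A * γ K := fun K => by
    rw [hγ]; simp only; rw [mul_div_cancel₀ _ (pow_ne_zero A two_ne_zero)]
  have hγI : ∀ K, K ≤ N → Rat.padicValuation 2 (γ K) ≤ 1 := fun K hK => by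
    have h := padicValuation_div_two_pow_le A (holeWeight_two_le hAB hK (hgI (2 * K + 1) (by omega)))
    rw [neg_add_cancel, exp_zero] at h
    simpa only [hγ, hG] using h
  have hγS : ∀ K, K ≤ N → γ (N - K) + γ K = 0 := fun K hK => by
    rw [hγ]; simp only; rw [← add_div, hG, holeWeight_two_reflect hA hgS hK, zero_div]
  have hγD : ∀ e K K', e ≤ L → K ≤ N → K' ≤ N → (2 : ℤ) ^ e ∣ (K : ℤ) - K' →
      Rat.padicValuation 2 (γ K' - γ K) ≤ exp (-((e : ℤ) + 1)) := fun e K K' he hK hK' hdvd => by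
    rw [hγ]; simp only; rw [← sub_div]
    have h := padicValuation_div_two_pow_le A (holeWeight_two_local hAB hgS hgD he hK hK' hdvd)
    exact h.trans (by rw [exp_le_exp]; omega)
  obtain ⟨Hs, H0⟩ := IH N hN' γ hγI hγS hγD
  refine ⟨fun s => ?_, ?_⟩
  · have hred := level_reduction_two_even hAB hN hgI hA1 s
    have hmain : Rat.padicValuation 2 (∑ K ∈ range (N + 1 + 1),
        blockWeight A B 0 2 0 (N + 1) g K * ((2 : ℚ) ^ (L * (A - s)) * cell A B 0 (N + 1) K s)) ≤ exp (-((L : ℤ) + 1)) := by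
      rw [← hW, show ∑ K ∈ range (N + 1 + 1), W K * ((2 : ℚ) ^ (L * (A - s)) * cell A B 0 (N + 1) K s) =
        ∑ K ∈ range (N + 1 + 1), ((2 : ℚ) ^ 1 * ω K) * ((2 : ℚ) ^ (L * (A - s)) * cell A B 0 (N + 1) K s) from
          Finset.sum_congr rfl fun K _ => by rw [hWω K], sum_pow_mul, map_mul, padicValuation_two_pow]
      calc _ ≤ exp (-((1 : ℕ) : ℤ)) * exp (-(L : ℤ)) := mul_le_mul' le_rfl (IHs s)
        _ = _ := by rw [← exp_add]; congr 1; push_cast; ring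
    have hhole : Rat.padicValuation 2 (∑ K ∈ range (N + 1),
        holeWeight A B 0 2 0 N g K * ((2 : ℚ) ^ (L * (A - s)) * cell A B 0 N K s)) ≤ exp (-((L : ℤ) + 1)) := by
      rw [← hG, show ∑ K ∈ range (N + 1), G K * ((2 : ℚ) ^ (L * (A - s)) * cell A B 0 N K s) =
        ∑ K ∈ range (N + 1), ((2 : ℚ) ^ A * γ K) * ((2 : ℚ) ^ (L * (A - s)) * cell A B 0 N K s) from
          Finset.sum_congr rfl fun K _ => by rw [hGγ K], sum_pow_mul, map_mul, padicValuation_two_pow]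
      calc _ ≤ exp (-(A : ℤ)) * exp (-(L : ℤ)) := mul_le_mul' le_rfl (Hs s)
        _ ≤ _ := by rw [← exp_add, exp_le_exp]; omega
    have h := Valuation.map_add_le _ (Valuation.map_add_le _ hred hhole) hmain
    rwa [sub_add_cancel, sub_add_cancel] at h
  · have hred := level_reduction_two_even_zero hAB hN hgI hA1
    have hmain : Rat.padicValuation 2 (∑ K ∈ range (N + 1 + 1),
        blockWeight A B 0 2 0 (N + 1) g K * ((2 : ℚ) ^ (L * A) * cellZero A B 0 (N + 1) K)) ≤ exp (-((L : ℤ) + 1)) := by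
      rw [← hW, show ∑ K ∈ range (N + 1 + 1), W K * ((2 : ℚ) ^ (L * A) * cellZero A B 0 (N + 1) K) =
        ∑ K ∈ range (N + 1 + 1), ((2 : ℚ) ^ 1 * ω K) * ((2 : ℚ) ^ (L * A) * cellZero A B 0 (N + 1) K) from
          Finset.sum_congr rfl fun K _ => by rw [hWω K], sum_pow_mul, map_mul, padicValuation_two_pow]
      calc _ ≤ exp (-((1 : ℕ) : ℤ)) * exp (-(L : ℤ)) := mul_le_mul' le_rfl IH0
        _ = _ := by rw [← exp_add]; congr 1; push_cast; ring
    have hhole : Rat.padicValuation 2 (∑ K ∈ range (N + 1),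
        holeWeight A B 0 2 0 N g K * ((2 : ℚ) ^ (L * A) * cellZero A B 0 N K)) ≤ exp (-((L : ℤ) + 1)) := by
      rw [← hG, show ∑ K ∈ range (N + 1), G K * ((2 : ℚ) ^ (L * A) * cellZero A B 0 N K) =
        ∑ K ∈ range (N + 1), ((2 : ℚ) ^ A * γ K) * ((2 : ℚ) ^ (L * A) * cellZero A B 0 N K) from
          Finset.sum_congr rfl fun K _ => by rw [hGγ K], sum_pow_mul, map_mul, padicValuation_two_pow]
      calc _ ≤ exp (-(A : ℤ)) * exp (-(L : ℤ)) := mul_le_mul' le_rfl H0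
        _ ≤ _ := by rw [← exp_add, exp_le_exp]; omega
    have h := Valuation.map_add_le _ (Valuation.map_add_le _ hred hhole) hmain
    rwa [sub_add_cancel, sub_add_cancel] at h

end step

/-! ## PROPOSITION H at the prime `2` -/

/-- **PROPOSITION H at `p = 2`.**  For `A` even, `1 ≤ B`, `2B ≤ A`, EVERY level `ℓ`, every row `M < 2^{ℓ+1}` of the
centre-free kernel `(A,B,0)` and every weight `g` that is 2-ADMISSIBLE at level `ℓ` — (I) `v₂(g(k)) ≤ 1`,
(S) `g(M−k) + g(k) = 0` exactly, (D⁺) `2^e ∣ k − k′ ⇒ v₂(g(k′) − g(k)) ≤ exp(−(e+1))` for every `e ≤ ℓ` —: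
`v₂(Σ_{k≤M} g(k)·2^{ℓ(A−s)}·c̃_{k,s}(M)) ≤ exp(−ℓ)` for every `s`, and `v₂(Σ_{k≤M} g(k)·2^{ℓA}·c̃⁰_k(M)) ≤ exp(−ℓ)`.
(The odd-prime statement is `BrickPropositionHInf.propositionH_inf`; at `2` the class carries exact antisymmetry and one
more factor `2` of digit-locality, `e = 0` included.) -/
theorem propositionH_two {A B : ℕ} (hA : Even A) (hB : 1 ≤ B) (hAB : 2 * B ≤ A) :
    ∀ ℓ : ℕ, ∀ M : ℕ, M < 2 ^ (ℓ + 1) → ∀ g : ℕ → ℚ, (∀ k, k ≤ M → Rat.padicValuation 2 (g k) ≤ 1) →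
      (∀ k, k ≤ M → g (M - k) + g k = 0) →
      (∀ e k k', e ≤ ℓ → k ≤ M → k' ≤ M → (2 : ℤ) ^ e ∣ (k : ℤ) - k' →
        Rat.padicValuation 2 (g k' - g k) ≤ exp (-((e : ℤ) + 1))) →
      (∀ s, Rat.padicValuation 2 (∑ k ∈ range (M + 1), g k * ((2 : ℚ) ^ (ℓ * (A - s)) * cell A B 0 M k s)) ≤
        exp (-(ℓ : ℤ))) ∧
      Rat.padicValuation 2 (∑ k ∈ range (M + 1), g k * ((2 : ℚ) ^ (ℓ * A) * cellZero A B 0 M k)) ≤ exp (-(ℓ : ℤ)) := by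
  intro ℓ
  induction ℓ with
  | zero =>
    intro M hM g hgI _ _
    rw [zero_add, pow_one] at hM
    simp only [Nat.cast_zero, neg_zero, exp_zero, zero_mul, pow_zero, one_mul]
    refine ⟨fun s => Valuation.map_sum_le _ fun k hk => ?_, Valuation.map_sum_le _ fun k hk => ?_⟩
    · have hk' : k ≤ M := by have := mem_range.1 hk; omega
      rw [map_mul]; exact mul_le_one' (hgI k hk') (cell_zero_integral_of_lt hAB hM hk' s)
    · have hk' : k ≤ M := by have := mem_range.1 hk; omega
      rw [map_mul, cellZero_eq, Valuation.map_neg]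
      refine mul_le_one' (hgI k hk') (Valuation.map_sum_le _ fun s _ => ?_)
      rw [map_mul]
      exact mul_le_one' (cell_zero_integral_of_lt hAB hM hk' s) (hsum_integral_of_lt (by omega) s)
  | succ L ih =>
    intro M hM g hgI hgS hgD
    have hpow : 2 ^ (L + 1 + 1) = 2 * 2 ^ (L + 1) := by rw [pow_succ]; ring
    rcases Nat.even_or_odd' M with ⟨N, hMN | hMN⟩
    · rcases N with _ | N
      · -- the empty row `M = 0`: `g(0) = 0`
        obtain rfl : M = 0 := by omega
        have h0 : g 0 = 0 := by have h := hgS 0 le_rfl; rw [Nat.sub_zero] at h; linarith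
        simp only [zero_add, Finset.sum_range_one, h0, zero_mul, map_zero]
        exact ⟨fun _ => _root_.zero_le, _root_.zero_le⟩
      · -- even row `M = 2N+2`
        obtain rfl : M = 2 * N + 2 := by omega
        have hN : N + 1 < 2 ^ (L + 1) := by omega
        have h := level_step_two_even hA hB hAB (fun M' hM' g' h1 h2 h3 => ih M' hM' g' h1 h2 h3) hN hgI hgS hgD
        exact ⟨fun s => by exact_mod_cast h.1 s, by exact_mod_cast h.2⟩
    · -- odd row `M = 2N+1`
      subst hMN
      have hN : N < 2 ^ (L + 1) := by omega
      have h := level_step_two_odd hA hB hAB (fun M' hM' g' h1 h2 h3 => ih M' hM' g' h1 h2 h3) hN hgI hgS hgD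
      exact ⟨fun s => by exact_mod_cast h.1 s, by exact_mod_cast h.2⟩

/-- **The weight `n − 2k`**: for `A` even, `1 ≤ B`, `2B ≤ A`, every `ℓ` and `n < 2^{ℓ+1}`:
`v₂(Σ_{k≤n} (n−2k)·2^{ℓ(A−s)}c̃_{k,s}(n)) ≤ exp(−ℓ)` (all `s`) and `v₂(Σ_{k≤n} (n−2k)·2^{ℓA}c̃⁰_k(n)) ≤ exp(−ℓ)` — the weight
is integral, exactly antisymmetric, and `(n−2k′) − (n−2k) = 2(k − k′)` is digit-local with one factor `2` to spare. -/
theorem propositionH_two_linear {A B : ℕ} (hA : Even A) (hB : 1 ≤ B) (hAB : 2 * B ≤ A) (ℓ n : ℕ) (hn : n < 2 ^ (ℓ + 1)) :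
    (∀ s, Rat.padicValuation 2 (∑ k ∈ range (n + 1),
        ((n : ℚ) - 2 * k) * ((2 : ℚ) ^ (ℓ * (A - s)) * cell A B 0 n k s)) ≤ exp (-(ℓ : ℤ))) ∧
      Rat.padicValuation 2 (∑ k ∈ range (n + 1),
        ((n : ℚ) - 2 * k) * ((2 : ℚ) ^ (ℓ * A) * cellZero A B 0 n k)) ≤ exp (-(ℓ : ℤ)) := by
  refine propositionH_two hA hB hAB ℓ n hn (fun k => (n : ℚ) - 2 * k) (fun k _ => ?_) (fun k hk => ?_)
    (fun e k k' _ _ _ hdvd => ?_)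
  · rw [show (n : ℚ) - 2 * k = (((n : ℤ) - 2 * k : ℤ) : ℚ) by push_cast; ring, Rat.padicValuation_cast]
    exact Int.padicValuation_le_one _ _
  · push_cast [Nat.cast_sub hk]; ring
  · rw [show ((n : ℚ) - 2 * k') - ((n : ℚ) - 2 * k) = 2 * ((k : ℚ) - k') by ring, map_mul, padicValuation_two]
    calc _ ≤ exp (-1 : ℤ) * exp (-(e : ℤ)) := mul_le_mul' le_rfl (padicValuation_natCast_sub_le hdvd)
      _ = _ := by rw [← exp_add]; congr 1; ring

/-! ## Zudilin's 2002 integrality -/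

/-- **Zudilin's integrality (Mat. Zametki 72 (2002), Sect. 1 display before (6), Sect. 2 (14)–(15)) as a theorem of the
tree**: `4D_n²qₙ ∈ ℤ`, `4D_n⁷pₙ ∈ ℤ`, `4D_n⁵p̃ₙ ∈ ℤ` for every `n ≥ 1` (`D_n = lcm(1,…,n)`; `qₙ, pₙ, p̃ₙ` the solutions of
his recursion (1) with the printed initial data).  DISCHARGES the named fact
`Literature.NumberTheory.Irrationality.Zudilin2002.integrality`: ct-1 g39–g41 reduced it to PROPOSITION H at `p = 2` for
the centre-free kernel `(6,1,0)` and the one weight `n − 2k` (`integrality_of_propositionH_two`), which is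
`propositionH_two_linear` at `(A,B) = (6,1)`.  An integrality statement about rational numbers — nothing about the
arithmetic nature of `ζ(5)` or `ζ(3)`. [cite: Zudilin2002Zeta5, Sect. 2 (14)–(15)] -/
theorem integrality_holds : integrality :=
  integrality_of_propositionH_two fun ℓ n hn =>
    propositionH_two_linear (A := 6) (B := 1) (by decide) le_rfl (by norm_num) ℓ n hn

end

end Summit.KontsevichZagierPeriods.Zeta5Search.BrickPropositionHTwo
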